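import Literature.AlgebraicGeometry.Motives.LocalSystems
import HarnessLib

/-!
# Local systems: global sections are monodromy invariants (proofs)

Discharge of the named fact
`Literature.AlgebraicGeometry.Motives.LocalSystem.range_flatSectionsEval_eq_invariants`
(stated in `Literature/AlgebraicGeometry/Motives/LocalSystems.lean`): on a path-connected base
`S`, evaluation at `s` identifies the flat (global) sections `Γ(S, V)` of a local system
`V : Π₁(S) ⥤ ModuleCat R` with the invariants `V_s^{π₁(S,s)}` of the monodromy representation.

## Source and proof
Deligne, *Équations différentielles à points singuliers réguliers*, LNM 163 (1970), I §1:
1.2 (transport isomorphisms `a(F) : F_{a(0)} → F_{a(1)}` depend only on the homotopy class,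
`ab(F) = a(F) b(F)`, whence the action of `π₁(X, x₀)` on `F_{x₀}`), Prop. 1.3 / Cor. 1.4 (on a
connected base, `F ↦ F_{x₀}` is an equivalence between local systems and representations of
`π₁(X, x₀)`); the present statement is the case `Hom(const, V) = Γ(S, V)` of that equivalence
(Voisin, *Hodge Theory and Complex Algebraic Geometry I*, §9.2). The elementary proof formalised:
* `⊆`: a flat section is fixed by transport along every path class, in particular along loops
  at `s`, so its value at `s` is monodromy invariant (`mem_invariants_monodromyRep_iff`).
* `⊇`: given an invariant `x ∈ V_s`, put `v t := transport γ_t x` for *some* path class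
  `γ_t : s ⟶ t` (path-connectedness). For `δ : t ⟶ w` the loop `γ_t · δ · γ_w⁻¹` fixes `x`,
  which is exactly `transport δ (v t) = v w` (`transport_transport_eq_of_mem_invariants`);
  and `v s = transport γ_s x = x` since `γ_s` is a loop.

## Contents
* `LocalSystem.mem_invariants_monodromyRep_iff`, `LocalSystem.transport_transport_eq_of_mem_invariants`,
  `LocalSystem.exists_flatSectionsEval_eq_of_mem_invariants` (proved helpers);
* `LocalSystem.range_flatSectionsEval_eq_invariants_holds` (the discharge);
* `LocalSystem.nonempty_flatSections_linearEquiv_invariants`: `Γ(S, V) ≃ₗ[R] V_s^{π₁(S,s)}`.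

No new definitions or named facts are introduced here (pure proofs over the existing API).
The sibling `LocalSystemsProofs.lean` discharges `isTrivial_of_simplyConnectedSpace`; this file
is independent of it.
-/

open CategoryTheory

universe u

namespace Literature.AlgebraicGeometry.Motives

namespace LocalSystem

section Ring

variable {R : Type u} [Ring R] {S : Type u} [TopologicalSpace S] (V : LocalSystem R S)

/-- Path independence of transport of a monodromy-fixed vector: if `x ∈ V_s` is fixed by
transport along every loop at `s`, then transporting `x` to `t` along `γ` and on to `w` along
`δ` agrees with transporting it directly along any `γ' : s ⟶ w` — the loop `γ δ γ'⁻¹` fixes `x`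
(Deligne 1970, I.1.2: `ab(F) = a(F) b(F)`). [cite: Deligne1970, I.1.2] -/
theorem transport_transport_eq_of_forall_transport_eq (s : S) (x : V.fiber s)
    (hx : ∀ ℓ : Path.Homotopic.Quotient s s, V.transport ℓ x = x) {t w : S}
    (γ : Path.Homotopic.Quotient s t) (δ : Path.Homotopic.Quotient t w)
    (γ' : Path.Homotopic.Quotient s w) :
    V.transport δ (V.transport γ x) = V.transport γ' x := by
  have key : V.transport ((γ.trans δ).trans γ'.symm) x = x := hx _
  calc V.transport δ (V.transport γ x)
      = V.transport (γ.trans δ) x := by rw [transport_trans]; rfl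
    _ = V.transport (((γ.trans δ).trans γ'.symm).trans γ') x := by
        rw [Path.Homotopic.Quotient.trans_assoc (γ.trans δ),
          Path.Homotopic.Quotient.symm_trans, Path.Homotopic.Quotient.trans_refl]
    _ = V.transport γ' (V.transport ((γ.trans δ).trans γ'.symm) x) := by
        rw [transport_trans]; rfl
    _ = V.transport γ' x := by rw [key]

end Ring

section CommRing

variable {R : Type u} [CommRing R] {S : Type u} [TopologicalSpace S] (V : LocalSystem R S)

/-- Monodromy invariance unfolded: `x ∈ V_s^{π₁(S,s)}` iff every loop class at `s` transports
`x` to itself (Deligne 1970, I.1.2: `π₁(X, x₀)` acts on the fibre through the transport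
isomorphisms `a(F)`). [cite: Deligne1970, I.1.2] -/
theorem mem_invariants_monodromyRep_iff (s : S) (x : V.fiber s) :
    x ∈ Representation.invariants (V.monodromyRep s) ↔
      ∀ γ : Path.Homotopic.Quotient s s, V.transport γ x = x :=
  Representation.mem_invariants _ _

/-- Path independence of transport of a monodromy-invariant vector (the `Representation`
form of `transport_transport_eq_of_forall_transport_eq`; Deligne 1970, I.1.2).
[cite: Deligne1970, I.1.2] -/
theorem transport_transport_eq_of_mem_invariants (s : S) (x : V.fiber s)
    (hx : x ∈ Representation.invariants (V.monodromyRep s)) {t w : S}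
    (γ : Path.Homotopic.Quotient s t) (δ : Path.Homotopic.Quotient t w)
    (γ' : Path.Homotopic.Quotient s w) :
    V.transport δ (V.transport γ x) = V.transport γ' x :=
  V.transport_transport_eq_of_forall_transport_eq s x
    ((V.mem_invariants_monodromyRep_iff s x).1 hx) γ δ γ'

/-- Existence of the flat section through a monodromy-invariant vector: on a path-connected
base every `x ∈ V_s^{π₁(S,s)}` is the value at `s` of a flat section (unique by
`flatSectionsEval_injective`), namely `t ↦ transport ⟦somePath s t⟧ x`
(Deligne 1970, I.1.2–Cor. I.1.4; Voisin I, §9.2). [cite: Deligne1970, Cor. I.1.4] -/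
theorem exists_flatSectionsEval_eq_of_mem_invariants [PathConnectedSpace S] (s : S)
    (x : V.fiber s) (hx : x ∈ Representation.invariants (V.monodromyRep s)) :
    ∃ v : V.flatSections, V.flatSectionsEval s v = x := by
  refine ⟨⟨fun t => V.transport ⟦PathConnectedSpace.somePath s t⟧ x, fun t w δ =>
    V.transport_transport_eq_of_mem_invariants s x hx _ δ _⟩, ?_⟩
  exact (V.mem_invariants_monodromyRep_iff s x).1 hx _

/-- **Global sections are monodromy invariants** — discharge of the named fact
`range_flatSectionsEval_eq_invariants`: on a path-connected base,
`range (flatSectionsEval s) = V_s^{π₁(S,s)}`. `⊆`: a flat section is by definition fixed by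
transport along every path class, in particular along loops at `s`. `⊇`:
`exists_flatSectionsEval_eq_of_mem_invariants`. This is the case `Hom(const, V) = Γ(S, V)` of
Deligne's equivalence "local systems on a connected `X` ≃ representations of `π₁(X, x₀)`,
`F ↦ F_{x₀}`" (Deligne 1970, Prop. I.1.3 / Cor. I.1.4; Voisin, *Hodge Theory I*, §9.2).
[cite: Deligne1970, Cor. I.1.4] -/
theorem range_flatSectionsEval_eq_invariants_holds : V.range_flatSectionsEval_eq_invariants := by
  intro _ s
  apply le_antisymm
  · rintro x ⟨v, rfl⟩
    rw [mem_invariants_monodromyRep_iff]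
    intro γ
    exact v.2 s s γ
  · intro x hx
    exact V.exists_flatSectionsEval_eq_of_mem_invariants s x hx

/-- `Γ(S, V) ≃ₗ[R] V_s^{π₁(S,s)}` on a path-connected base: evaluation at `s` is injective
(`flatSectionsEval_injective`) with range the monodromy invariants
(`range_flatSectionsEval_eq_invariants_holds`), so the flat sections are linearly equivalent to
the invariants (Deligne 1970, Cor. I.1.4; Voisin I, §9.2). [cite: Deligne1970, Cor. I.1.4] -/
theorem nonempty_flatSections_linearEquiv_invariants [PathConnectedSpace S] (s : S) :
    Nonempty (V.flatSections ≃ₗ[R] Representation.invariants (V.monodromyRep s)) :=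
  ⟨(LinearEquiv.ofInjective _ (V.flatSectionsEval_injective s)).trans
    (LinearEquiv.ofEq _ _ (V.range_flatSectionsEval_eq_invariants_holds s))⟩

end CommRing

end LocalSystem

end Literature.AlgebraicGeometry.Motives
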